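import Summits.BirchSwinnertonDyer.BirchSwinnertonDyer.Theorems.GenusKolyvaginAtTwoKFourCellHalvingDescentPairSeparation
import Summits.BirchSwinnertonDyer.BirchSwinnertonDyer.Theorems.GenusKolyvaginAtTwoGenusDeepSupplyAtTwoNegDiscNarrowKFourCellHalvingDescentKFourNeg
import Summits.BirchSwinnertonDyer.BirchSwinnertonDyer.Theorems.GenusKolyvaginAtTwoOffCutResidualAtTwoRLw2PhantomExclusionKLW
import Summits.BirchSwinnertonDyer.BirchSwinnertonDyer.Theorems.GenusKolyvaginAtTwoGenusPrimitiveSupplyAtTwoTwistingPrimeDepthOne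
import Summits.BirchSwinnertonDyer.BirchSwinnertonDyer.Theorems.GenusKolyvaginAtTwoVisiblePairAtTwoHeegnerClassKummer
import HarnessLib

/-!
# Route `GenusKolyvaginAtTwo`, crux K₄⁻ `K4Neg` (stmt-BirchSwinnertonDyer-31526) — THE PHANTOM CELL F4ᵖᵍ: the K₄⁻ witness from ONE sharp
# Selmer class whose top bits miss the phantom, and the Heegner top bit read as «no extra 2-divisibility of `y_K` over the 2-division field»

LEAD seat `bsd-line-gk2-p1` g28, `--supports stmt-BirchSwinnertonDyer-31526 --as helper`.  THEOREMS ONLY; no `sorry`.  **BSD is NOT proved here;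
K4Neg is NOT proved; nothing is closed.**

Sequel of `…KFourCellHalvingDescentPairSeparation` (B2Q♭ with (NPh_K) replaced by the top-bit pair separation `hSep`).  The pair is
(`S`, `Y`) = (`ι(res s₀)`, `ι(c_M(1))`) at level `2^(M+2)`; `hSep` forbids a NON-ZERO PHANTOM among the `2`-torsion combinations `aS + bY`, i.e. among
the three top bits `S'`, `Y'`, `S' + Y'`.  This file:
* §1 `zsmul_kolyvaginClass_one_eq_zero_of_phantom_of_descent` — THE HEEGNER TOP BIT.  `c_M(1)` is the Kummer class of `y_K = P(1) ∈ E(K)`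
  (`VisiblePairAtTwo.kolyvaginClass_one_two_eq_kummerMapTorsion`), so `b • ι(c_M(1))` is a phantom iff the `2^M`-division point `Q` of `b·y_K` is FIXED by
  `Γ_{K(E[2^(M+2)])}` (`[κ(Q), ρ] = ρQ − Q`).  Hence the `Y`-part of `hSep` follows from the DESCENT HYPOTHESIS `hDesc`: «a multiple of `y_K` that is
  `2^M`-divisible by a point fixed by `Γ_{K(E[2^(M+2)])}` is `2^M`-divisible in `E(K)`» — equivalently (Lawson–Wuthrich uniqueness) «the Kummer class of
  the generator of `E(K) ⊗ ℤ₂` is not the phantom `ξ_K`», equivalently «`ξ_E` is not the twin's Selmer class `δ(z_d)`».  This is the honest residual of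
  the phantom cell at the Heegner class; it is a per-frame condition, generically true, and checkable by `2`-descent on the twin.
* §2 `kFourNeg_shape_of_topBits` — the K4Neg CONCLUSION SHAPE (`n = ℓ` prime, `FrobEqFrobInfty`, `P(ℓ) ∉ 2E(K[ℓ])`) on any K₄⁻-type frame with `Δ < 0`
  (no cut, any reduction at `2`), modulo Q2, from: one `s₀ ∈ Sel_(2^M)(E/ℚ)` (`M ≥ M₀+1`, `2^(M₀−1)•s₀ ≠ 0`) whose own top bit is not a phantom (`hS`) and
  does not combine with the Heegner top bit to a phantom (`hSY`), plus `hDesc`.  The `Δ < 0` pair supply and everything else are tree theorems.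
What remains for the phantom cell (recorded, not proved here): the SUPPLY of such an `s₀` from WALL + U₂ (Cassels–Tate: `Ш(E/ℚ)[2^∞] ≅ (ℤ/2^(M₀))²`
gives three sharp classes with pairwise distinct top bits, at most two of which can violate `hS`/`hSY`).
References: [McCallumLMS1991] §5; [Kolyvagin1989Izv] Thm. B₂; [LawsonWuthrich2016] §7.1; [SilvermanAEC2009] VIII.2; [GrossLMS1991] §9.
-/

set_option autoImplicit false
-- the Theorems namespace of this sub repeats the summit name by design (D-0017 nested layout)
set_option linter.dupNamespace false

noncomputable section

open scoped Classical AddSubgroup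

namespace Summit.BirchSwinnertonDyer.BirchSwinnertonDyer.Theorems.GenusExact.PlusDescent

open WeierstrassCurve NumberField IsDedekindDomain Field Rat.HeightOneSpectrum Literature.NumberTheory.EllipticCurves
  Literature.NumberTheory.GaloisRepresentations Literature.NumberTheory.EllipticCurves.ModularForms AddSubgroup
  Literature.NumberTheory.EllipticCurves.RingClassField
open Summit.BirchSwinnertonDyer.BirchSwinnertonDyer.Theses.GenusKolyvaginAtTwo (KolyvaginRelationAtTwo)
open Summit.BirchSwinnertonDyer.BirchSwinnertonDyer.Theorems.GenusExact

/-! ## §1 The Heegner top bit: phantom ⟺ a division point of a multiple of `y_K` fixed by the division field -/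

/-- **THE HEEGNER TOP BIT (`Y`-part of the pair separation) from the descent hypothesis.**  `E/ℚ` elliptic, globally minimal; `K` imaginary quadratic
with `d_K` odd, Heegner; `ρ̄_{E,2}` onto; a conductor-`1` datum `d₁` and the `K`-rational Heegner point `Ph = y_K` under it; levels `2^M ∣ 2^L`.  If every
multiple `b • y_K` whose `2^M`-division point in `E(K̄)` is fixed by `Γ_{K(E[2^L])}` is `2^M`-divisible in `E(K)` (`hDesc`), then no non-zero class
`b • ι(c_M(1))` dies on `Γ_{K(E[2^L])}`: `c_M(1) = κ_M(y_K)` (`VisiblePairAtTwo.kolyvaginClass_one_two_eq_kummerMapTorsion`), `[ι x, ρ] = 0 ↔ [x, ρ] = 0`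
(`Lw2PhantomExclusion.h1Eval_torsionH1OfDvd_eq_zero_iff`), `[κ(Q), ρ] = ρQ − Q` (`GenusKolyTwistingPrime.coe_h1Eval_kummerClassTorsion`), and the kernel
of the Kummer map (`kummerMapTorsion_ker`).  BSD is NOT proved by this. [cite: SilvermanAEC2009, VIII.2 (Kummer pairing)] [cite: GrossLMS1991, §9] -/
theorem zsmul_kolyvaginClass_one_eq_zero_of_phantom_of_descent
    (W : WeierstrassCurve ℚ) [W.IsElliptic] [W.IsGloballyMinimal] [NeZero (W.conductorNorm ℤ)]
    (K : Type) [Field K] [NumberField K] (hIQ : IsImaginaryQuadratic K) (hodd : Odd (NumberField.discr K))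
    (hHe : SatisfiesHeegnerHypothesis (W.conductorNorm ℤ) K) (hρ1 : W.HasSurjectiveModNGaloisRep ((2 : ℤ) ^ 1))
    (Dt : ModularParametrizationData W (W.conductorNorm ℤ)) (β : ℤ) (ι : K →+* ℂ) (d₁ : KolyvaginHeegnerData Dt β ι 1)
    (Ph : (W.baseChange K).toAffine.Point)
    (hPh : WeierstrassCurve.Affine.Point.map (W' := W) (algebraMap K (ringClassField K ι 1)).toRatAlgHom Ph = d₁.derivedPoint)
    (M : ℕ) {L : ℕ} (hd : ((2 ^ M : ℕ) : ℤ) ∣ ((2 ^ L : ℕ) : ℤ))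
    (hDesc : ∀ (b : ℤ) (Q : geomPoints (W.baseChange K)),
      (∀ ρ ∈ torsionFixing (W.baseChange K) ((2 ^ L : ℕ) : ℤ), ρ • Q = Q) →
      ((2 ^ M : ℕ) : ℤ) • Q = toGeomPoints (W.baseChange K) (b • Ph) →
      ∃ R : (W.baseChange K).toAffine.Point, ((2 ^ M : ℕ) : ℤ) • R = b • Ph)
    (b : ℤ)
    (hphantom : ∀ ρ ∈ torsionFixing (W.baseChange K) ((2 ^ L : ℕ) : ℤ),
      h1Eval (W.baseChange K) ((2 ^ L : ℕ) : ℤ) (b • torsionH1OfDvd (W.baseChange K) hd (d₁.kolyvaginClass Nat.prime_two M)) ρ = 0) :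
    b • torsionH1OfDvd (W.baseChange K) hd (d₁.kolyvaginClass Nat.prime_two M) = 0 := by
  haveI hell : (W.baseChange K).IsElliptic := inferInstanceAs ((W.map (algebraMap ℚ K)).IsElliptic)
  have hn0 : (((2 ^ M : ℕ) : ℤ)) ≠ 0 := by exact_mod_cast pow_ne_zero M two_ne_zero
  have hdiv : ∀ P : geomPoints (W.baseChange K), ∃ Q : geomPoints (W.baseChange K), ((2 ^ M : ℕ) : ℤ) • Q = P :=
    (W.baseChange K).zsmul_geomPoints_surjective_of_charZero hn0
  have hc1 : d₁.kolyvaginClass Nat.prime_two M = kummerMapTorsion (W.baseChange K) ((2 ^ M : ℕ) : ℤ) hdiv Ph :=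
    VisiblePairAtTwo.kolyvaginClass_one_two_eq_kummerMapTorsion W K hIQ hodd hHe hρ1 M d₁ Ph hPh
  -- the `2^M`-division point of `b • y_K`
  set Q := zsmulRoot (W.baseChange K) ((2 ^ M : ℕ) : ℤ) hdiv (b • Ph) with hQdef
  have hQ : ((2 ^ M : ℕ) : ℤ) • Q = toGeomPoints (W.baseChange K) (b • Ph) := zsmul_zsmulRoot (W.baseChange K) _ hdiv (b • Ph)
  have hκ : kummerMapTorsion (W.baseChange K) ((2 ^ M : ℕ) : ℤ) hdiv (b • Ph) =
      kummerClassTorsion (W.baseChange K) ((2 ^ M : ℕ) : ℤ) Q (by rw [hQ]; exact toGeomPoints_mem_fixedPoints _ _) := by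
    rw [kummerMapTorsion_apply]
    exact kummerMapTorsionFun_eq (W.baseChange K) _ hdiv (b • Ph) Q hQ
  -- `Q` is fixed by `Γ_{K(E[2^L])}`
  have hQfix : ∀ ρ ∈ torsionFixing (W.baseChange K) ((2 ^ L : ℕ) : ℤ), ρ • Q = Q := by
    intro ρ hρ
    have h0 := hphantom ρ hρ
    rw [hc1, ← map_zsmul, ← map_zsmul, Lw2PhantomExclusion.h1Eval_torsionH1OfDvd_eq_zero_iff (W.baseChange K) hd _ hρ, hκ] at h0
    have hρM : ρ ∈ torsionFixing (W.baseChange K) ((2 ^ M : ℕ) : ℤ) := KolyvaginLowerBoundAtTwo.torsionFixing_le_of_dvd _ hd hρ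
    have hc := GenusKolyTwistingPrime.coe_h1Eval_kummerClassTorsion (W.baseChange K) ((2 ^ M : ℕ) : ℤ) Q
      (by rw [hQ]; exact toGeomPoints_mem_fixedPoints _ _) hρM
    rw [h0, ZeroMemClass.coe_zero, eq_comm, sub_eq_zero] at hc
    exact hc
  -- descent: `b • y_K ∈ 2^M E(K)`, so its Kummer class vanishes
  obtain ⟨R, hR⟩ := hDesc b Q hQfix hQ
  have hker : kummerMapTorsion (W.baseChange K) ((2 ^ M : ℕ) : ℤ) hdiv (b • Ph) = 0 := by
    have hmem : b • Ph ∈ (zsmulAddGroupHom (α := (W.baseChange K).toAffine.Point) ((2 ^ M : ℕ) : ℤ)).range := ⟨R, by simpa using hR⟩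
    rw [← kummerMapTorsion_ker (W.baseChange K) ((2 ^ M : ℕ) : ℤ) hdiv] at hmem
    exact hmem
  rw [hc1, ← map_zsmul, ← map_zsmul, hker, map_zero]

/-! ## §2 The K4Neg shape on the phantom cell from one sharp class with good top bits -/

/-- **K4Neg's CONCLUSION SHAPE from ONE sharp Selmer class whose top bits miss the phantom (no cut, any reduction at `2`; modulo Q2).**
Frame: `E/ℚ` globally minimal, non-CM, `Δ < 0`, odd Tamagawa product, `ρ_{E,2^n}` onto; `K` imaginary quadratic, `d_K` odd `≠ −3`, Heegner, the two
Theorem-B₂ non-square side conditions; `d₁` with its `K`-rational point `y_K` and `2^(M₀+1) ∤ P(1)`; `w(E) = +1`; `M ≥ M₀ + 1`; `s₀ ∈ Sel_(2^M)(E/ℚ)`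
with `2^(M₀−1) • s₀ ≠ 0`.  Hypotheses on the top bits at level `2^(M+2)`: `hS` — no non-zero `2`-torsion multiple of `ι(res s₀)` is a phantom;
`hSY` — no sum of a non-zero `2`-torsion multiple of `ι(res s₀)` and a non-zero `2`-torsion multiple of `ι(c_M(1))` is a phantom; `hDesc` — the descent
hypothesis of §1.  **Conclusion: `∃ n` square-free, `∃ d : KolyvaginHeegnerData Dt β ι n`, every `ℓ ∣ n` a Zhang–Kolyvagin prime at `2` of index `≥ 2`
with `FrobEqFrobInfty W K 2 ℓ`, and `P(n) ∉ 2E(K[n])`** (`n = ℓ` prime).  Proof: `hSep` of `…_of_pairSeparation_of_pairSupply` from `hS`/`hSY`/§1 by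
cases, the `Δ < 0` pair supply `pairSupply_frobEqFrobInfty_of_Δ_neg`.  BSD is NOT proved; K4Neg is NOT proved (WALL/U₂ supply of `s₀` and `hDesc`
remain). [cite: McCallumLMS1991, §5 Thm. 5.4] [cite: Kolyvagin1989Izv, Thm. B₂] [cite: LawsonWuthrich2016, §7.1] -/
theorem kFourNeg_shape_of_topBits (hQ2 : KolyvaginRelationAtTwo)
    (W : WeierstrassCurve ℚ) [W.IsElliptic] [W.IsGloballyMinimal] [NeZero (W.conductorNorm ℤ)] (hcm : ¬ W.HasCM) (hneg : W.Δ < 0)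
    (hT : Odd W.tamagawaProduct)
    (K : Type) [Field K] [NumberField K] (hIQ : IsImaginaryQuadratic K) (hodd : Odd (NumberField.discr K))
    (h3 : NumberField.discr K ≠ -3) (hHe : SatisfiesHeegnerHypothesis (W.conductorNorm ℤ) K)
    (hsq1 : ¬ IsSquare ((NumberField.discr K : ℚ) * -|W.Δ|)) (hsq2 : ¬ IsSquare ((NumberField.discr K : ℚ) * (-(2 * |W.Δ|))))
    (hρ : ∀ n : ℕ, 0 < n → W.HasSurjectiveModNGaloisRep ((2 : ℤ) ^ n))
    (Dt : ModularParametrizationData W (W.conductorNorm ℤ)) (β : ℤ) (ι : K →+* ℂ) (d₁ : KolyvaginHeegnerData Dt β ι 1)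
    (Ph : (W.baseChange K).toAffine.Point)
    (hPh : WeierstrassCurve.Affine.Point.map (W' := W) (algebraMap K (ringClassField K ι 1)).toRatAlgHom Ph = d₁.derivedPoint)
    (M₀ : ℕ) (hndiv : ¬ ∃ Q : (W.baseChange (ringClassField K ι 1)).toAffine.Point, ((2 ^ (M₀ + 1) : ℕ) : ℤ) • Q = d₁.derivedPoint)
    (hw1 : W.rootNumber = 1)
    (M : ℕ) (hM₀M : M₀ + 1 ≤ M) (s₀ : galH1Torsion W ((2 ^ M : ℕ) : ℤ)) (hs₀ : s₀ ∈ selmerGroup W ((2 ^ M : ℕ) : ℤ))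
    (hne : ((2 ^ (M₀ - 1) : ℕ) : ℤ) • s₀ ≠ 0)
    (hS : ∀ (hd : ((2 ^ M : ℕ) : ℤ) ∣ ((2 ^ (M + 2) : ℕ) : ℤ)) (a : ℤ),
      (2 : ℤ) • (a • torsionH1OfDvd (W.baseChange K) hd (resTorsion W K ((2 ^ M : ℕ) : ℤ) s₀)) = 0 →
      (∀ ρ' ∈ torsionFixing (W.baseChange K) ((2 ^ (M + 2) : ℕ) : ℤ),
        h1Eval (W.baseChange K) ((2 ^ (M + 2) : ℕ) : ℤ) (a • torsionH1OfDvd (W.baseChange K) hd (resTorsion W K ((2 ^ M : ℕ) : ℤ) s₀)) ρ' = 0) →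
      a • torsionH1OfDvd (W.baseChange K) hd (resTorsion W K ((2 ^ M : ℕ) : ℤ) s₀) = 0)
    (hSY : ∀ (hd : ((2 ^ M : ℕ) : ℤ) ∣ ((2 ^ (M + 2) : ℕ) : ℤ)) (a b : ℤ),
      (2 : ℤ) • (a • torsionH1OfDvd (W.baseChange K) hd (resTorsion W K ((2 ^ M : ℕ) : ℤ) s₀)) = 0 →
      (2 : ℤ) • (b • torsionH1OfDvd (W.baseChange K) hd (d₁.kolyvaginClass Nat.prime_two M)) = 0 →
      a • torsionH1OfDvd (W.baseChange K) hd (resTorsion W K ((2 ^ M : ℕ) : ℤ) s₀) ≠ 0 →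
      b • torsionH1OfDvd (W.baseChange K) hd (d₁.kolyvaginClass Nat.prime_two M) ≠ 0 →
      ∃ ρ' ∈ torsionFixing (W.baseChange K) ((2 ^ (M + 2) : ℕ) : ℤ),
        h1Eval (W.baseChange K) ((2 ^ (M + 2) : ℕ) : ℤ)
          (a • torsionH1OfDvd (W.baseChange K) hd (resTorsion W K ((2 ^ M : ℕ) : ℤ) s₀) +
            b • torsionH1OfDvd (W.baseChange K) hd (d₁.kolyvaginClass Nat.prime_two M)) ρ' ≠ 0)
    (hDesc : ∀ (b : ℤ) (Q : geomPoints (W.baseChange K)),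
      (∀ ρ ∈ torsionFixing (W.baseChange K) ((2 ^ (M + 2) : ℕ) : ℤ), ρ • Q = Q) →
      ((2 ^ M : ℕ) : ℤ) • Q = toGeomPoints (W.baseChange K) (b • Ph) →
      ∃ R : (W.baseChange K).toAffine.Point, ((2 ^ M : ℕ) : ℤ) • R = b • Ph) :
    ∃ (n : ℕ) (d : KolyvaginHeegnerData Dt β ι n), Squarefree n ∧
      (∀ ℓ ∈ n.primeFactors, Zhang2014.IsKolyvaginPrime (W.conductorNorm ℤ) W K 2 ℓ ∧ 2 ≤ Zhang2014.kolyvaginIndex W 2 ℓ ∧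
        FrobEqFrobInfty W K 2 ℓ) ∧
      ¬ ∃ Q : (W.baseChange (ringClassField K ι n)).toAffine.Point, (2 : ℤ) • Q = d.derivedPoint := by
  haveI : Fact (Nat.Prime 2) := ⟨Nat.prime_two⟩
  have hρ1 : W.HasSurjectiveModNGaloisRep ((2 : ℤ) ^ 1) := hρ 1 one_pos
  -- assemble `hSep` from `hS`, `hSY` and the Heegner top bit (§1)
  have hSep : ∀ (hd : ((2 ^ M : ℕ) : ℤ) ∣ ((2 ^ (M + 2) : ℕ) : ℤ)) (a b : ℤ),
      (2 : ℤ) • (a • torsionH1OfDvd (W.baseChange K) hd (resTorsion W K ((2 ^ M : ℕ) : ℤ) s₀)) = 0 →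
      (2 : ℤ) • (b • torsionH1OfDvd (W.baseChange K) hd (d₁.kolyvaginClass Nat.prime_two M)) = 0 →
      (∀ ρ' ∈ torsionFixing (W.baseChange K) ((2 ^ (M + 2) : ℕ) : ℤ),
        h1Eval (W.baseChange K) ((2 ^ (M + 2) : ℕ) : ℤ)
          (a • torsionH1OfDvd (W.baseChange K) hd (resTorsion W K ((2 ^ M : ℕ) : ℤ) s₀) +
            b • torsionH1OfDvd (W.baseChange K) hd (d₁.kolyvaginClass Nat.prime_two M)) ρ' = 0) →
      a • torsionH1OfDvd (W.baseChange K) hd (resTorsion W K ((2 ^ M : ℕ) : ℤ) s₀) +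
        b • torsionH1OfDvd (W.baseChange K) hd (d₁.kolyvaginClass Nat.prime_two M) = 0 := by
    intro hd a b h2a h2b hab
    by_cases ha : a • torsionH1OfDvd (W.baseChange K) hd (resTorsion W K ((2 ^ M : ℕ) : ℤ) s₀) = 0
    · rw [ha, zero_add] at hab ⊢
      exact zsmul_kolyvaginClass_one_eq_zero_of_phantom_of_descent W K hIQ hodd hHe hρ1 Dt β ι d₁ Ph hPh M hd hDesc b hab
    by_cases hb : b • torsionH1OfDvd (W.baseChange K) hd (d₁.kolyvaginClass Nat.prime_two M) = 0
    · rw [hb, add_zero] at hab ⊢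
      exact hS hd a h2a hab
    · obtain ⟨ρ', hρ', hne'⟩ := hSY hd a b h2a h2b ha hb
      exact (hne' (hab ρ' hρ')).elim
  obtain ⟨ℓ, d, hkol, hidx, hΦ, -, -, -, hwit⟩ :=
    exists_primitive_of_two_pow_pred_smul_ne_zero_of_pairSeparation_of_pairSupply (fun ℓ ↦ FrobEqFrobInfty W K 2 ℓ) hQ2 W hcm hT K hIQ hodd
      h3 hHe hρ hsq1 hsq2 Dt β ι d₁ M₀ hndiv hw1 (pairSupply_frobEqFrobInfty_of_Δ_neg W hcm hneg K hIQ hsq1 hρ) M hM₀M s₀ hs₀ hne hSep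
  have hℓp : ℓ.Prime := hkol.1
  refine ⟨1 * ℓ, d, by rw [one_mul]; exact hℓp.squarefree, fun q hq ↦ ?_, hwit⟩
  rw [one_mul, hℓp.primeFactors, Finset.mem_singleton] at hq
  subst hq
  exact ⟨hkol, le_trans (by omega) hidx, hΦ⟩

end Summit.BirchSwinnertonDyer.BirchSwinnertonDyer.Theorems.GenusExact.PlusDescent

end
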